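import Summits.ResolutionOfSingularities.ResolutionOfSingularities.Theorems.FrobeniusLadderFRationalResolutionCharacteristicTowerIterate
import Summits.ResolutionOfSingularities.ResolutionOfSingularities.Theorems.FrobeniusLadderFRationalResolutionCharacteristicTowerCentre
import HarnessLib

/-!
# Crux `FrobeniusLadder.FRationalResolution` (stmt-ResolutionOfSingularities-15317), line `redirect`,
# stub `stub_diagonalizableQuotientResolution` — INTRINSIC TOWERS OF ANY LENGTH SETTLE THE TWISTED POINT: «blow up a characteristic centre, then
# repeatedly the REDUCED SINGULAR LOCUS (points or curves), until regular» (MEMO-15317-leafhand2-g17 §5: 195/311 isolated classes have a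
# one-dimensional singular locus after the first step, so curve centres are needed; this is their interface)

`…CharacteristicTowerIterate.exists_characteristic_ideal_isRegular_of_itower` (p839169) packages a tower of blowing ups with covering-automorphism-stable
centres into one characteristic ideal; `…CharacteristicTowerCentre` (p839044) shows that vanishing ideals of automorphism-stable closed sets — in
particular REDUCED SINGULAR LOCI of any dimension — are such centres. Composed with the one-ideal interface p838347:

* ★★★ `hloc_of_intrinsic_itower` — Galois data of p838347; a proper characteristic `J₁ ⊇ (𝔔'Ê)ⁿ`; a tower `X_N → ⋯ → X_0 = Bl_{J₁}(Spec Ê)` in which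
  `X_{i+1} → X_i` is a blowing up of the vanishing ideal of a CLOSED set `Z_i ⊆ X_i` lying over `V(𝔔'Ê)` and mapped into itself by the automorphisms of `X_i`
  covering automorphisms of `Spec Ê`; `X_N` regular ⇒ `hloc` at the twisted point;
* ★★★ `hloc_of_singularLocus_itower` — the same with `Z_i = Sing X_i` (closed, over `V(𝔔'Ê)`): stability is automatic.

Honest label: assembly toward ONE leaf stub (no stub, crux or summit closed); whether iterated blowing up of reduced singular loci terminates for a given toric
class is a fan computation not done here. No definitions, no named facts, no sorry.
[cite: StacksProject, Tag 080B; Tag 0CDQ; Tag 09EB] [cite: Matsumura1987, Thm. 8.11; Thm. 8.14] [cite: GortzWedhorn2020, Prop. 13.91]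
-/

noncomputable section

-- single-problem summit: the doubled namespace component is forced
set_option linter.dupNamespace false

open CategoryTheory CategoryTheory.Limits AlgebraicGeometry TopologicalSpace TensorProduct IsLocalRing
open Literature.AlgebraicGeometry.Resolution
open Summit.ResolutionOfSingularities.ResolutionOfSingularities.Theorems.FRationalResolution

namespace Summit.ResolutionOfSingularities.ResolutionOfSingularities.Theorems.FRationalResolution.IntrinsicTower

/-- **A tower of blowing ups of stable closed sets over `V(𝔪)`, starting from a characteristic `J₁`, with regular top, is `Bl` of one characteristic
`𝔪`-primary ideal with regular blowing up** (ring form). [cite: StacksProject, Tag 080B] [folklore] -/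
theorem exists_characteristic_ideal_isRegular_of_closedSets_itower {R : Type} [CommRing R] [IsNoetherianRing R] (𝔪 J₁ : Ideal R) {n : ℕ}
    (hn : 𝔪 ^ n ≤ J₁) (hJ₁top : J₁ ≠ ⊤) (hJ₁ : ∀ θ : R ≃+* R, J₁.map (θ : R →+* R) ≤ J₁)
    (X : ℕ → Scheme.{0}) (q : ∀ i, X i ⟶ Spec (.of R)) (hq0 : IsBlowup (q 0) (affineBlowup.idealSheaf J₁))
    (Z : ∀ i, Set (X i)) (hZc : ∀ i, IsClosed (Z i))
    (hZstab : ∀ i, ∀ Θ : X i ≅ X i, (∃ σ : Spec (.of R) ⟶ Spec (.of R), Θ.hom ≫ q i = q i ≫ σ) → Θ.hom '' Z i ⊆ Z i)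
    (hZ𝔪 : ∀ i, ∀ z ∈ Z i, 𝔪 ≤ (q i z).asIdeal)
    (π : ∀ i, X (i + 1) ⟶ X i) (hπ : ∀ i, IsBlowup (π i) (Scheme.IdealSheafData.vanishingIdeal ⟨Z i, hZc i⟩))
    (hcomp : ∀ i, π i ≫ q i = q (i + 1)) (N : ℕ) (hreg : Scheme.IsRegular (X N)) :
    ∃ (J : Ideal R) (c : ℕ), (∀ θ : R ≃+* R, J.map (θ : R →+* R) ≤ J) ∧ 𝔪 ^ c ≤ J ∧ J ≠ ⊤ ∧ Scheme.IsRegular (affineBlowup J) :=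
  CharacteristicTowerIterate.exists_characteristic_ideal_isRegular_of_itower 𝔪 J₁ hn hJ₁top hJ₁ X q hq0
    (fun i => Scheme.IdealSheafData.vanishingIdeal ⟨Z i, hZc i⟩) π hπ hcomp
    (fun i Θ hΘ => CharacteristicTowerCentre.comap_vanishingIdeal_le_of_image_subset Θ ⟨Z i, hZc i⟩ (hZstab i Θ hΘ))
    (fun _ => 1) (fun i => by
      rw [pow_one]
      exact CharacteristicTowerCentre.idealSheaf_comap_le_vanishingIdeal_of_subset (q i) 𝔪 ⟨Z i, hZc i⟩ (hZ𝔪 i))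
    N hreg

/-- ★★★ **INTRINSIC TOWERS OF ANY LENGTH SETTLE THE TWISTED POINT.** See the module docstring.
[cite: StacksProject, Tag 080B; Tag 0CDQ; Tag 09EB] [cite: Matsumura1987, Thm. 8.11; Thm. 8.14] -/
theorem hloc_of_intrinsic_itower (K : Type) [Field K] (X : Scheme.{0}) [IsIntegral X]
    (f : X ⟶ Spec (.of K)) [LocallyOfFiniteType f]
    {B : Type} [CommRing B] [IsDomain B] [Algebra K B] [Algebra.FiniteType K B]
    (ι : Spec (.of B) ⟶ X) [IsOpenImmersion ι] (hι : ι ≫ f = Spec.map (CommRingCat.ofHom (algebraMap K B)))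
    (𝔭 : Ideal B) [h𝔭 : 𝔭.IsMaximal] (h𝔭0 : 𝔭 ≠ ⊥)
    (hsing : ι ⟨𝔭, h𝔭.isPrime⟩ ∉ Scheme.regularLocus X)
    (hregB : ∀ P : Spec (.of B), P.asIdeal ≠ 𝔭 → P ∈ Scheme.regularLocus (Spec (.of B)))
    (K' : Type) [Field K'] [Algebra K K'] [FiniteDimensional K K'] [IsGalois K K']
    (𝔔' : Ideal (B ⊗[K] K')) [h𝔔' : 𝔔'.IsMaximal] (h𝔔'𝔭 : 𝔔'.comap (algebraMap B (B ⊗[K] K')) = 𝔭)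
    (J₁ : Ideal (AdicCompletion (maximalIdeal (Localization.AtPrime 𝔔')) (Localization.AtPrime 𝔔'))) {n : ℕ}
    (hn : 𝔔'.map (algebraMap (B ⊗[K] K')
      (AdicCompletion (maximalIdeal (Localization.AtPrime 𝔔')) (Localization.AtPrime 𝔔'))) ^ n ≤ J₁)
    (hJ₁top : J₁ ≠ ⊤)
    (hchar : ∀ θ : AdicCompletion (maximalIdeal (Localization.AtPrime 𝔔')) (Localization.AtPrime 𝔔') ≃+*
        AdicCompletion (maximalIdeal (Localization.AtPrime 𝔔')) (Localization.AtPrime 𝔔'), J₁.map (θ : _ →+* _) ≤ J₁)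
    (T : ℕ → Scheme.{0})
    (q : ∀ i, T i ⟶ Spec (.of (AdicCompletion (maximalIdeal (Localization.AtPrime 𝔔')) (Localization.AtPrime 𝔔'))))
    (hq0 : IsBlowup (q 0) (affineBlowup.idealSheaf J₁))
    (Z : ∀ i, Set (T i)) (hZc : ∀ i, IsClosed (Z i))
    (hZstab : ∀ i, ∀ Θ : T i ≅ T i, (∃ σ : _ ⟶ _, Θ.hom ≫ q i = q i ≫ σ) → Θ.hom '' Z i ⊆ Z i)
    (hZ𝔪 : ∀ i, ∀ z ∈ Z i, 𝔔'.map (algebraMap (B ⊗[K] K')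
      (AdicCompletion (maximalIdeal (Localization.AtPrime 𝔔')) (Localization.AtPrime 𝔔'))) ≤ (q i z).asIdeal)
    (π : ∀ i, T (i + 1) ⟶ T i) (hπ : ∀ i, IsBlowup (π i) (Scheme.IdealSheafData.vanishingIdeal ⟨Z i, hZc i⟩))
    (hcomp : ∀ i, π i ≫ q i = q (i + 1)) (N : ℕ) (hreg : Scheme.IsRegular (T N)) :
    ∃ (V : X.Opens), ι ⟨𝔭, h𝔭.isPrime⟩ ∈ V ∧
      (∀ t : X, t ∉ Scheme.regularLocus X → t ∈ V → t = ι ⟨𝔭, h𝔭.isPrime⟩) ∧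
      ∃ (Y : Scheme.{0}) (ρ : Y ⟶ V), IsProper ρ ∧ Scheme.IsRegular Y ∧
        IsIso (ρ ∣_ (V.ι ⁻¹ᵁ ⟨Scheme.regularLocus X, isOpen_regularLocus_of_locallyOfFiniteType_field f⟩)) ∧
        Dense ((ρ ⁻¹ᵁ (V.ι ⁻¹ᵁ ⟨Scheme.regularLocus X,
          isOpen_regularLocus_of_locallyOfFiniteType_field f⟩) : Y.Opens) : Set Y) := by
  haveI : IsNoetherianRing B := Algebra.FiniteType.isNoetherianRing K B
  haveI : Algebra.FiniteType B (B ⊗[K] K') := inferInstance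
  haveI : IsNoetherianRing (B ⊗[K] K') := Algebra.FiniteType.isNoetherianRing B (B ⊗[K] K')
  haveI : IsNoetherianRing (Localization.AtPrime 𝔔') :=
    IsLocalization.isNoetherianRing 𝔔'.primeCompl (Localization.AtPrime 𝔔') inferInstance
  haveI : IsNoetherianRing (AdicCompletion (maximalIdeal (Localization.AtPrime 𝔔')) (Localization.AtPrime 𝔔')) :=
    isNoetherianRing_adicCompletion_maximalIdeal _
  obtain ⟨J, c, hcharJ, hc, hJtop, hregJ⟩ :=
    exists_characteristic_ideal_isRegular_of_closedSets_itower _ J₁ hn hJ₁top hchar T q hq0 Z hZc hZstab hZ𝔪 π hπ hcomp N hreg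
  exact GaloisCharacteristicCentre.hloc_of_characteristic_ideal_adicCompletion K X f ι hι 𝔭 h𝔭0 hsing hregB K' 𝔔' h𝔔'𝔭 J hc
    hJtop (fun θ => hcharJ θ) hregJ

/-- ★★★ **The same with `Z_i = Sing X_i`** (closed singular loci over `V(𝔔'Ê)`; stability under automorphisms is automatic).
[cite: StacksProject, Tag 080B; Tag 0CDQ; Tag 09EB] [folklore] -/
theorem hloc_of_singularLocus_itower (K : Type) [Field K] (X : Scheme.{0}) [IsIntegral X]
    (f : X ⟶ Spec (.of K)) [LocallyOfFiniteType f]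
    {B : Type} [CommRing B] [IsDomain B] [Algebra K B] [Algebra.FiniteType K B]
    (ι : Spec (.of B) ⟶ X) [IsOpenImmersion ι] (hι : ι ≫ f = Spec.map (CommRingCat.ofHom (algebraMap K B)))
    (𝔭 : Ideal B) [h𝔭 : 𝔭.IsMaximal] (h𝔭0 : 𝔭 ≠ ⊥)
    (hsing : ι ⟨𝔭, h𝔭.isPrime⟩ ∉ Scheme.regularLocus X)
    (hregB : ∀ P : Spec (.of B), P.asIdeal ≠ 𝔭 → P ∈ Scheme.regularLocus (Spec (.of B)))
    (K' : Type) [Field K'] [Algebra K K'] [FiniteDimensional K K'] [IsGalois K K']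
    (𝔔' : Ideal (B ⊗[K] K')) [h𝔔' : 𝔔'.IsMaximal] (h𝔔'𝔭 : 𝔔'.comap (algebraMap B (B ⊗[K] K')) = 𝔭)
    (J₁ : Ideal (AdicCompletion (maximalIdeal (Localization.AtPrime 𝔔')) (Localization.AtPrime 𝔔'))) {n : ℕ}
    (hn : 𝔔'.map (algebraMap (B ⊗[K] K')
      (AdicCompletion (maximalIdeal (Localization.AtPrime 𝔔')) (Localization.AtPrime 𝔔'))) ^ n ≤ J₁)
    (hJ₁top : J₁ ≠ ⊤)
    (hchar : ∀ θ : AdicCompletion (maximalIdeal (Localization.AtPrime 𝔔')) (Localization.AtPrime 𝔔') ≃+*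
        AdicCompletion (maximalIdeal (Localization.AtPrime 𝔔')) (Localization.AtPrime 𝔔'), J₁.map (θ : _ →+* _) ≤ J₁)
    (T : ℕ → Scheme.{0})
    (q : ∀ i, T i ⟶ Spec (.of (AdicCompletion (maximalIdeal (Localization.AtPrime 𝔔')) (Localization.AtPrime 𝔔'))))
    (hq0 : IsBlowup (q 0) (affineBlowup.idealSheaf J₁))
    (hZc : ∀ i, IsClosed (Scheme.regularLocus (T i))ᶜ)
    (hZ𝔪 : ∀ i, ∀ z ∈ (Scheme.regularLocus (T i))ᶜ, 𝔔'.map (algebraMap (B ⊗[K] K')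
      (AdicCompletion (maximalIdeal (Localization.AtPrime 𝔔')) (Localization.AtPrime 𝔔'))) ≤ (q i z).asIdeal)
    (π : ∀ i, T (i + 1) ⟶ T i)
    (hπ : ∀ i, IsBlowup (π i) (Scheme.IdealSheafData.vanishingIdeal ⟨(Scheme.regularLocus (T i))ᶜ, hZc i⟩))
    (hcomp : ∀ i, π i ≫ q i = q (i + 1)) (N : ℕ) (hreg : Scheme.IsRegular (T N)) :
    ∃ (V : X.Opens), ι ⟨𝔭, h𝔭.isPrime⟩ ∈ V ∧
      (∀ t : X, t ∉ Scheme.regularLocus X → t ∈ V → t = ι ⟨𝔭, h𝔭.isPrime⟩) ∧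
      ∃ (Y : Scheme.{0}) (ρ : Y ⟶ V), IsProper ρ ∧ Scheme.IsRegular Y ∧
        IsIso (ρ ∣_ (V.ι ⁻¹ᵁ ⟨Scheme.regularLocus X, isOpen_regularLocus_of_locallyOfFiniteType_field f⟩)) ∧
        Dense ((ρ ⁻¹ᵁ (V.ι ⁻¹ᵁ ⟨Scheme.regularLocus X,
          isOpen_regularLocus_of_locallyOfFiniteType_field f⟩) : Y.Opens) : Set Y) :=
  hloc_of_intrinsic_itower K X f ι hι 𝔭 h𝔭0 hsing hregB K' 𝔔' h𝔔'𝔭 J₁ hn hJ₁top hchar T q hq0 (fun i => (Scheme.regularLocus (T i))ᶜ) hZc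
    (fun _ Θ _ => CharacteristicTowerCentre.image_compl_regularLocus_subset Θ) hZ𝔪 π hπ hcomp N hreg

end Summit.ResolutionOfSingularities.ResolutionOfSingularities.Theorems.FRationalResolution.IntrinsicTower

end
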